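import Summits.CriticalPhenomena.Ising3D.TaylorRegionDeltaLitEvenP
import Mathlib.Tactic.Linarith
import Mathlib.Tactic.Positivity
import Mathlib.Tactic.Ring
import HarnessLib

/-!
# Tail θ-cells with a per-cell choice of column enclosure: Taylor shift (landed) or interval Horner (10× cheaper)
(cell `pub-ising3x`, seat recog-1 gen 13; gate (g2) — kernel measurements HOME/pub-ising3x-recog-1/gen13/KERNEL-DELTA.md)

HONEST FRAMING: lottery ticket; floor = tightest certified 3D Ising CFT bounds; no exact-solution
claim without a proof. Island framing: certified exclusion region at stated derivative order and
assumptions; not a determination of the 3D Ising critical exponents beyond that.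

The `(E, θ)` tail cells of the region certificates enclose every column polynomial (degree `R − 1 = 48` in `θ` at
`Λ = 11`) over the θ-cell by a Taylor SHIFT (`enclI`: ≈ 1.2 k interval products per column) — MEASURED ≈ 27 s per
`X`/`Y` cell and 45–70 s per discriminant cell in the kernel. On a narrow cell an interval HORNER evaluation
(`hornerI`, 49 products per column) is almost always as conclusive (prototype on a real functional: 124 of 128 `X`
cells, ≈ 90 % of the discriminant cells) at a tenth of the cost; the few cells near `θ → 1` keep the shift. This file:
`hornerI` / `enclIH` (+ `mem_hornerI`, `mem_enclIH`), `colEnclM … (horner : Bool)` (+ `pmem_colEnclM`), the cell tests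
`cellOKM` / `cellOKDM` with a MODE flag, and the soundness theorems **`halfStripPos2M_sound`** / **`halfStripPosDM_sound`**
taking one Boolean per cell with producer-chosen modes (`modes : List Bool`) — the proofs are the landed ones
(`halfStripPos2_sound`, `halfStripPosD_sound`) with `pmem_colEncl` replaced by `pmem_colEnclM`. Elementary. [folklore]
-/

namespace Summit.CriticalPhenomena.Ising3D

open Finset Set
open Literature.Analysis.ValidatedNumerics Literature.Analysis.ValidatedNumerics.PolyMP
open Literature.Analysis.ValidatedNumerics.NumericsMP (MI)
open Literature.MathematicalPhysics.QuantumFieldTheory.ConformalBootstrap3D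

/-! ### Interval Horner evaluation -/

/-- Interval Horner evaluation of an interval polynomial at an interval argument `T`. [folklore] -/
def hornerI (S : ℕ) (p : IPoly) (T : MI) : MI := p.foldr (fun I acc => MI.add I (MI.mul S acc T)) (MI.ofInt S 0)

/-- [folklore] -/
theorem mem_hornerI {S : ℕ} (hS : 0 < S) {t : ℝ} {T : MI} (ht : MI.mem S t T) :
    ∀ {as : List ℝ} {p : IPoly}, PMem S as p → MI.mem S (evalR as t) (hornerI S p T)
  | _, _, List.Forall₂.nil => by simpa [hornerI] using MI.mem_ofInt S 0
  | _, _, List.Forall₂.cons (a := a) (b := I) (l₁ := as) (l₂ := p) ha hp => by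
      have ih := mem_hornerI hS ht hp
      have h := MI.mem_add ha (MI.mem_mul hS ih ht)
      simp only [hornerI, List.foldr_cons]
      rw [evalR_cons, show a + t * evalR as t = a + evalR as t * t by ring]
      exact h

/-- Horner enclosure of `p` on the θ-cell `|θ − c| ≤ h`. [folklore] -/
def enclIH (S : ℕ) (p : IPoly) (c h : ℚ) : MI := hornerI S p (enclQ S (c - h) (c + h))

/-- [folklore] -/
theorem mem_enclIH {S : ℕ} (hS : 0 < S) {as : List ℝ} {p : IPoly} (has : PMem S as p) {c h : ℚ} {θ : ℝ}
    (hθ : |θ - c| ≤ h) : MI.mem S (evalR as θ) (enclIH S p c h) := by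
  have h1 : ((c - h : ℚ) : ℝ) ≤ θ := by push_cast; linarith [(abs_le.mp hθ).1]
  have h2 : θ ≤ ((c + h : ℚ) : ℝ) := by push_cast; linarith [(abs_le.mp hθ).2]
  exact mem_hornerI hS (mem_enclQ S h1 h2) has

/-- Column enclosures on a θ-cell with a MODE flag: `true` = interval Horner, `false` = the landed Taylor shift. [folklore] -/
def colEnclM (S : ℕ) (H : IPoly2) (M : ℕ) (c h : ℚ) (horner : Bool) : IPoly :=
  if horner then (List.range M).map fun i => enclIH S (colI H i) c h else colEncl S H M c h

/-- [folklore] -/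
theorem pmem_colEnclM {S : ℕ} (hS : 0 < S) {G : List (List ℝ)} {H : IPoly2} (hG : PMem2 S G H) (M : ℕ)
    {c h : ℚ} (h0 : 0 ≤ h) {θ : ℝ} (hθ : |θ - c| ≤ h) (horner : Bool) :
    PMem S (colVals G M θ) (colEnclM S H M c h horner) := by
  cases horner with
  | false => exact pmem_colEncl hS hG M h0 hθ
  | true =>
      simp only [colEnclM, if_true, colVals]
      exact pmem_map (fun i => mem_enclIH hS (pmem_colI hG i) hθ) (List.range M)

/-! ### Cell tests with a mode flag -/

/-- One θ-cell of the positivity tail (`cellOK` with the enclosure mode). [folklore] -/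
def cellOKM (S : ℕ) (H : IPoly2) (M : ℕ) (P0 P1 c h : ℚ) (dP : ℕ) (horner : Bool) : Bool :=
  posLead (shiftI S (colEnclM S H M c h horner) (PolyMP.ofRat S P1)) &&
    (decide (P1 ≤ P0) || posOn S dP (colEnclM S H M c h horner) P0 P1)

/-- One θ-cell of the discriminant tail (`cellOKD` with the enclosure mode). [folklore] -/
def cellOKDM (S : ℕ) (HX HY HZ : IPoly2) (MX MY MZ : ℕ) (P0 P1 c h : ℚ) (dP : ℕ) (horner : Bool) : Bool :=
  posLead (dLocI S (colEnclM S HX MX c h horner) (colEnclM S HY MY c h horner) (colEnclM S HZ MZ c h horner)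
      (PolyMP.ofRat S P1)) &&
    (decide (P1 ≤ P0) ||
      posOnD S (colEnclM S HX MX c h horner) (colEnclM S HY MY c h horner) (colEnclM S HZ MZ c h horner) dP P0 P1)

/-- The `k`-th θ-cell test of leg `(H, prm)` with mode list `modes`. [folklore] -/
def hsCellM (S : ℕ) (H : IPoly2) (P0 : ℚ) (prm : HSParams) (modes : List Bool) (k : ℕ) : Bool :=
  cellOKM S H (effCols H (rowMax2I H)) P0 prm.P1 (prm.θhi * (2 * (k : ℚ) + 1) / (2 * (prm.nθ : ℚ)))
    (prm.θhi / (2 * (prm.nθ : ℚ))) prm.dP (modes.getD k false)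

/-- The `k`-th θ-cell test of the discriminant tail with mode list `modes`. [folklore] -/
def hsCellDM (S : ℕ) (HX HY HZ : IPoly2) (P0 : ℚ) (prm : HSParams) (modes : List Bool) (k : ℕ) : Bool :=
  cellOKDM S HX HY HZ (effCols HX (rowMax2I HX)) (effCols HY (rowMax2I HY)) (effCols HZ (rowMax2I HZ)) P0 prm.P1
    (prm.θhi * (2 * (k : ℚ) + 1) / (2 * (prm.nθ : ℚ))) (prm.θhi / (2 * (prm.nθ : ℚ))) prm.dP (modes.getD k false)

/-! ### Soundness: positivity tail -/

/-- **Soundness of the positivity tail from its mixed-mode cells** (the proof of `halfStripPos2_sound` with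
`pmem_colEnclM`). [folklore] -/
theorem halfStripPos2M_sound {S : ℕ} (hS : 0 < S) {G : List (List ℝ)} {H : IPoly2} (hG : PMem2 S G H) {P0 : ℚ}
    {prm : HSParams} {modes : List Bool} (hη : 0 < prm.θhi) (hn : 0 < prm.nθ)
    (hall : ∀ k : ℕ, k < prm.nθ → hsCellM S H P0 prm modes k = true) {P θ : ℝ} (hP : (P0 : ℝ) ≤ P) (hθ0 : 0 ≤ θ)
    (hθ1 : θ ≤ prm.θhi) : 0 < eval2 G P θ := by
  have hsz : rowMax2 G ≤ rowMax2I H := (rowMax2_eq_of_pmem2 hG).le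
  set M := effCols H (rowMax2I H) with hM
  have hnR : (0 : ℝ) < prm.nθ := by exact_mod_cast hn
  have hn1 : prm.nθ - 1 + 1 = prm.nθ := Nat.sub_add_cancel hn
  obtain ⟨k, hk, hk1, hk2⟩ := exists_mem_gridCell (fun k : ℕ => (prm.θhi : ℝ) * k / prm.nθ) (prm.nθ - 1)
    (Δ := θ) (by simpa using hθ0) (by
      show θ ≤ (prm.θhi : ℝ) * ((prm.nθ - 1 + 1 : ℕ) : ℝ) / prm.nθ
      rw [hn1, mul_div_assoc, div_self hnR.ne', mul_one]; exact hθ1)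
  have hk1' : (prm.θhi : ℝ) * k / prm.nθ ≤ θ := hk1
  have hk2' : θ ≤ (prm.θhi : ℝ) * ((k : ℝ) + 1) / prm.nθ := by
    have : θ ≤ (prm.θhi : ℝ) * ((k + 1 : ℕ) : ℝ) / prm.nθ := hk2
    push_cast at this; exact this
  have hkn : k < prm.nθ := by omega
  have hcell := hall k hkn
  simp only [hsCellM, cellOKM, Bool.and_eq_true, Bool.or_eq_true, decide_eq_true_eq] at hcell
  obtain ⟨htail, hbox⟩ := hcell
  have hid1 : (prm.θhi : ℝ) * (2 * (k : ℝ) + 1) / (2 * prm.nθ) - prm.θhi / (2 * prm.nθ) =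
      (prm.θhi : ℝ) * k / prm.nθ := by field_simp; ring
  have hid2 : (prm.θhi : ℝ) * (2 * (k : ℝ) + 1) / (2 * prm.nθ) + prm.θhi / (2 * prm.nθ) =
      (prm.θhi : ℝ) * ((k : ℝ) + 1) / prm.nθ := by field_simp; ring
  have hc : |θ - ((prm.θhi * (2 * (k : ℚ) + 1) / (2 * (prm.nθ : ℚ)) : ℚ) : ℝ)| ≤
      ((prm.θhi / (2 * (prm.nθ : ℚ)) : ℚ) : ℝ) := by
    push_cast; rw [abs_le]; constructor <;> linarith
  have hh0 : (0 : ℚ) ≤ prm.θhi / (2 * (prm.nθ : ℚ)) := by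
    have : (0 : ℚ) < prm.nθ := by exact_mod_cast hn
    positivity
  have hpm := pmem_colEnclM hS hG M hh0 hc (modes.getD k false)
  have hcv : evalR (colVals G M θ) P = eval2 G P θ := evalR_colVals_eff hS hG hsz P θ
  rw [← hcv]
  by_cases hPP : (prm.P1 : ℝ) ≤ P
  · have hsh := pmem_shiftI hS (mem_ofRat S prm.P1) hpm
    have hpos := evalR_pos_of_posLead hS hsh htail (y := P - prm.P1) (by linarith)
    rwa [evalR_shiftR, show (prm.P1 : ℝ) + (P - prm.P1) = P by ring] at hpos
  · have hlt : P < (prm.P1 : ℝ) := lt_of_not_ge hPP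
    rcases hbox with hvac | hposk
    · exact absurd ((show ((prm.P1 : ℚ) : ℝ) ≤ (P0 : ℝ) by exact_mod_cast hvac).trans hP) hPP
    · have hP0P1 : P0 ≤ prm.P1 := by
        have : (P0 : ℝ) ≤ prm.P1 := hP.trans hlt.le
        exact_mod_cast this
      exact posOn_sound hS hposk hP0P1 hpm hP hlt.le

/-! ### Soundness: discriminant tail -/

/-- **Soundness of the discriminant tail from its mixed-mode cells** (the proof of `halfStripPosD_sound` with
`pmem_colEnclM`). [folklore] -/
theorem halfStripPosDM_sound {S : ℕ} (hS : 0 < S) {GX GY GZ : List (List ℝ)} {HX HY HZ : IPoly2}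
    (hGX : PMem2 S GX HX) (hGY : PMem2 S GY HY) (hGZ : PMem2 S GZ HZ) {P0 : ℚ} {prm : HSParams}
    {modes : List Bool} (hη : 0 < prm.θhi) (hn : 0 < prm.nθ)
    (hall : ∀ k : ℕ, k < prm.nθ → hsCellDM S HX HY HZ P0 prm modes k = true) {P θ : ℝ} (hP : (P0 : ℝ) ≤ P)
    (hθ0 : 0 ≤ θ) (hθ1 : θ ≤ prm.θhi) : eval2 GZ P θ * eval2 GZ P θ < 4 * (eval2 GX P θ * eval2 GY P θ) := by
  have hszX : rowMax2 GX ≤ rowMax2I HX := (rowMax2_eq_of_pmem2 hGX).le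
  have hszY : rowMax2 GY ≤ rowMax2I HY := (rowMax2_eq_of_pmem2 hGY).le
  have hszZ : rowMax2 GZ ≤ rowMax2I HZ := (rowMax2_eq_of_pmem2 hGZ).le
  have hnR : (0 : ℝ) < prm.nθ := by exact_mod_cast hn
  have hn1 : prm.nθ - 1 + 1 = prm.nθ := Nat.sub_add_cancel hn
  obtain ⟨k, hk, hk1, hk2⟩ := exists_mem_gridCell (fun k : ℕ => (prm.θhi : ℝ) * k / prm.nθ) (prm.nθ - 1)
    (Δ := θ) (by simpa using hθ0) (by
      show θ ≤ (prm.θhi : ℝ) * ((prm.nθ - 1 + 1 : ℕ) : ℝ) / prm.nθ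
      rw [hn1, mul_div_assoc, div_self hnR.ne', mul_one]; exact hθ1)
  have hk1' : (prm.θhi : ℝ) * k / prm.nθ ≤ θ := hk1
  have hk2' : θ ≤ (prm.θhi : ℝ) * ((k : ℝ) + 1) / prm.nθ := by
    have : θ ≤ (prm.θhi : ℝ) * ((k + 1 : ℕ) : ℝ) / prm.nθ := hk2
    push_cast at this; exact this
  have hkn : k < prm.nθ := by omega
  have hcell := hall k hkn
  simp only [hsCellDM, cellOKDM, Bool.and_eq_true, Bool.or_eq_true, decide_eq_true_eq] at hcell
  obtain ⟨htail, hbox⟩ := hcell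
  have hid1 : (prm.θhi : ℝ) * (2 * (k : ℝ) + 1) / (2 * prm.nθ) - prm.θhi / (2 * prm.nθ) =
      (prm.θhi : ℝ) * k / prm.nθ := by field_simp; ring
  have hid2 : (prm.θhi : ℝ) * (2 * (k : ℝ) + 1) / (2 * prm.nθ) + prm.θhi / (2 * prm.nθ) =
      (prm.θhi : ℝ) * ((k : ℝ) + 1) / prm.nθ := by field_simp; ring
  have hc : |θ - ((prm.θhi * (2 * (k : ℚ) + 1) / (2 * (prm.nθ : ℚ)) : ℚ) : ℝ)| ≤
      ((prm.θhi / (2 * (prm.nθ : ℚ)) : ℚ) : ℝ) := by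
    push_cast; rw [abs_le]; constructor <;> linarith
  have hh0 : (0 : ℚ) ≤ prm.θhi / (2 * (prm.nθ : ℚ)) := by
    have : (0 : ℚ) < prm.nθ := by exact_mod_cast hn
    positivity
  have hpmX := pmem_colEnclM hS hGX (effCols HX (rowMax2I HX)) hh0 hc (modes.getD k false)
  have hpmY := pmem_colEnclM hS hGY (effCols HY (rowMax2I HY)) hh0 hc (modes.getD k false)
  have hpmZ := pmem_colEnclM hS hGZ (effCols HZ (rowMax2I HZ)) hh0 hc (modes.getD k false)
  rw [← evalR_colVals_eff hS hGX hszX P θ, ← evalR_colVals_eff hS hGY hszY P θ,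
    ← evalR_colVals_eff hS hGZ hszZ P θ]
  by_cases hPP : (prm.P1 : ℝ) ≤ P
  · have hsh := pmem_dLocI hS (mem_ofRat S prm.P1) hpmX hpmY hpmZ
    have hpos := evalR_pos_of_posLead hS hsh htail (y := P - prm.P1) (by linarith)
    rw [evalR_dLocR, show (prm.P1 : ℝ) + (P - prm.P1) = P by ring] at hpos
    linarith
  · have hlt : P < (prm.P1 : ℝ) := lt_of_not_ge hPP
    rcases hbox with hvac | hposk
    · exact absurd ((show ((prm.P1 : ℚ) : ℝ) ≤ (P0 : ℝ) by exact_mod_cast hvac).trans hP) hPP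
    · have hP0P1 : P0 ≤ prm.P1 := by
        have : (P0 : ℝ) ≤ prm.P1 := hP.trans hlt.le
        exact_mod_cast this
      exact posOnD_sound hS hpmX hpmY hpmZ hposk hP0P1 hP hlt.le

end Summit.CriticalPhenomena.Ising3D
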